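import Mathlib
import Literature.Analysis.ODE.MaximalTime
import Literature.Analysis.ODE.OneSidedComparison
import Literature.Barriers.NavierStokesRegularity.DyadicCascadeRegionNumerics
import HarnessLib

/-!
# The invariant region of Barbato–Morandin–Romito (BMR 2011, Lemma 2.1), proved

Barrier catalogue `Literature/Barriers/NavierStokesRegularity/`, fifth **proof file** towards the
named fact `Dyadic.BarbatoMorandinRomito2011_thm1` (`DyadicCascadeRegularity`). We prove the
invariant-region lemma in the form the proof of Theorem 1 uses it (`region_invariant`).

## Statement (abstract form) and relation to the printed Lemma 2.1

Let `Y₁, …, Y_N` be non-negative `C¹` functions on `[0, ∞)` with `Y₀ ≡ 0`, `Y_{N+1} ≡ Y_N`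
(BMR's border convention for the truncation (2.2)) solving
`Ẏₙ = -dₙYₙ + eₙ(Y_{n-1}² - G·YₙY_{n+1})`, `1 ≤ n ≤ N`, where `dₙ > 0`, `d_{n+1} = λ²dₙ = 4dₙ`
(viscosity `ν̄λₙ²`, `ν̄ > 0`), `eₙ > 0`, `e_{n+1} = Λeₙ` with `Λ = λ^{2-ε}`, and `G = λ^γ`,
`γ = 6 - 2β - 3ε` — this is (2.2) after extracting the common factors, for any `β ∈ (2, 5/2]`,
with the explicit choice `ε = 1/100` (so `Λ = 2^{1.99} ∈ [3.972, 3.9724]`, `1 ≤ G ≤ 4`,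
`c = G⁻¹ ≤ 0.511`, `DyadicCascadeRegionNumerics`). If at time `0` every pair lies in the closed
region `Ā`: `Yₙ ≤ 1`, `Y_{n+1} ≤ mYₙ + θ`, `Y_{n+1} ≥ h(Yₙ) = c((Yₙ-δ)₊/(1-δ))⁴` (`δ = 1/10`,
`θ = 3/5`, `m = 3/4`), then the same holds at all `t ≥ 0`.

Differences from the printed lemma, all on the safe side for Theorem 1: (i) the region is taken
**closed** (the printed `A` has `h(x) < y < g(x)`; data with vanishing leading modes, e.g. the
zero solution, lie on `∂A`, and the proof of Thm. 1 only uses the consequence `Yₙ ≤ 1`);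
(ii) `ν̄ > 0` (the printed lemma allows `ν ≥ 0`, needed only for the inviscid Theorem 2);
(iii) positivity `Yₙ ≥ 0` is an input (it is Cheskidov's Thm. 4.2, `DyadicCascadePositivity`),
so the edge `Yₙ = 0` (`n⃗₁`, `n⃗₆`) needs no discussion; (iv) `ε = 1/100` explicit.

## Proof

The printed proof checks that the vector field points inward on each of the six boundary pieces of
`A` ("it is sufficient to show that the derivative … points inward"). We run the corresponding
**first-exit argument**: let `t*` be the maximal time up to which all constraints hold
(`Literature.Analysis.ODE.maximalTimeP`); they hold on `[0, t*]` by continuity; if `t* < T`, each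
constraint holds *eventually after* `t*` — by continuity if it is strict at `t*`, and otherwise
because its time derivative at `t*` is **strictly negative** (`deriv_top_neg`, `deriv_upper_neg`,
`deriv_lower_neg` of `DyadicCascadeRegionNumerics`: the printed inequalities `𝔅·n⃗ᵢ ≥ 0`, strict
thanks to `ν̄ > 0` on the top and upper edges and to `ψ₂ > 0` on the lower edge; the lower edge
with `Yₙ < δ` is positivity of `Y_{n+1}`) — contradicting the exit principle. Finitely many
constraints, so "eventually" commutes with the conjunction. The lower boundary function
`h(x) = c((x-δ)₊/(1-δ))⁴` is `C¹` (`hasDerivAt_hlow`), which is what the exponent `λ² = 4` buys.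

## References

* D. Barbato, F. Morandin, M. Romito, *Smooth solutions for the dyadic model*, Nonlinearity 24
  (2011) 3083–3097, §2 Lemma 2.1 and its proof. [`BarbatoMorandinRomito2011`]
-/

noncomputable section

open Set Filter Asymptotics
open scoped Topology

namespace Literature.Barriers.NavierStokesRegularity.Dyadic

/-! ## The lower boundary function `h(x) = G⁻¹((x - 1/10)₊/(9/10))⁴` -/

/-- `h` vanishes on `x ≤ δ = 1/10`. [cite: BarbatoMorandinRomito2011, §2 (definition of `h`)] -/
theorem hlow_eq_zero_of_le (G : ℝ) {x : ℝ} (hx : x ≤ 1 / 10) :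
    1 / G * (max (x - 1 / 10) 0 / (9 / 10)) ^ 4 = 0 := by
  rw [max_eq_right (by linarith)]; simp

/-- `h(1) = c = G⁻¹`. [cite: BarbatoMorandinRomito2011, §2 (definition of `h`)] -/
theorem hlow_one (G : ℝ) : 1 / G * (max ((1 : ℝ) - 1 / 10) 0 / (9 / 10)) ^ 4 = 1 / G := by
  rw [max_eq_left (by norm_num)]; norm_num

/-- `h` is monotone: for `1 ≤ x`, `h(x) ≥ h(1) = G⁻¹` (`G > 0`). [folklore] -/
theorem one_div_le_hlow {G : ℝ} (hG : 0 < G) {x : ℝ} (hx : 1 ≤ x) :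
    1 / G ≤ 1 / G * (max (x - 1 / 10) 0 / (9 / 10)) ^ 4 := by
  rw [max_eq_left (by linarith)]
  have h1 : (1 : ℝ) ≤ (x - 1 / 10) / (9 / 10) := by rw [le_div_iff₀ (by norm_num)]; linarith
  have h4 : (1 : ℝ) ≤ ((x - 1 / 10) / (9 / 10)) ^ 4 := one_le_pow₀ h1
  have := mul_le_mul_of_nonneg_left h4 (one_div_pos.2 hG).le
  simpa using this

/-- `h(y) ≤ y` on `[0, 1]` when `G ≥ 1` (used for the last pair, where `Y_{N+1} = Y_N`). [folklore] -/
theorem hlow_le_self {G : ℝ} (hG : 1 ≤ G) {y : ℝ} (hy0 : 0 ≤ y) (hy1 : y ≤ 1) :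
    1 / G * (max (y - 1 / 10) 0 / (9 / 10)) ^ 4 ≤ y := by
  rcases le_or_gt y (1 / 10) with h | h
  · rw [hlow_eq_zero_of_le G h]; exact hy0
  · rw [max_eq_left (by linarith)]
    set u : ℝ := (y - 1 / 10) / (9 / 10) with hu
    have hu0 : 0 ≤ u := by rw [hu]; apply div_nonneg <;> linarith
    have hu1 : u ≤ 1 := by rw [hu, div_le_one (by norm_num)]; linarith
    have huy : u ≤ y := by rw [hu, div_le_iff₀ (by norm_num)]; linarith
    have hu4 : u ^ 4 ≤ u := by
      calc u ^ 4 ≤ u ^ 1 := pow_le_pow_of_le_one hu0 hu1 (by norm_num)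
        _ = u := pow_one u
    have hG' : 1 / G ≤ 1 := by rw [div_le_one (by linarith)]; exact hG
    have hG0 : 0 ≤ 1 / G := by positivity
    calc 1 / G * u ^ 4 ≤ 1 * u ^ 4 := mul_le_mul_of_nonneg_right hG' (by positivity)
      _ ≤ y := by linarith

/-- **`h` is `C¹`**: `h(x) = G⁻¹((x-δ)₊/(1-δ))⁴` has derivative `G⁻¹·4((x-δ)₊/(1-δ))³/(1-δ)`
at every `x` (including the corner `x = δ`, where both vanish: the exponent `λ² = 4 > 1` makes
the positive part smooth enough). [folklore] -/
theorem hasDerivAt_hlow (G x : ℝ) :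
    HasDerivAt (fun x : ℝ => 1 / G * (max (x - 1 / 10) 0 / (9 / 10)) ^ 4)
      (1 / G * (4 * (max (x - 1 / 10) 0 / (9 / 10)) ^ 3 * (1 / (9 / 10)))) x := by
  refine HasDerivAt.const_mul (1 / G) ?_
  rcases lt_trichotomy x (1 / 10) with hlt | heq | hgt
  · -- left of the corner: locally zero
    have hev : (fun x : ℝ => (max (x - 1 / 10) 0 / (9 / 10)) ^ 4) =ᶠ[𝓝 x] fun _ => 0 := by
      filter_upwards [Iio_mem_nhds hlt] with x' hx'
      rw [max_eq_right (by simp only [mem_Iio] at hx'; linarith)]; simp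
    have h0 : (4 * (max (x - 1 / 10) 0 / (9 / 10)) ^ 3 * (1 / (9 / 10)) : ℝ) = 0 := by
      rw [max_eq_right (by linarith)]; norm_num
    rw [h0]
    exact (hasDerivAt_const x (0 : ℝ)).congr_of_eventuallyEq hev
  · -- at the corner: `((x-δ)₊)⁴ = o(x - δ)`
    subst heq
    rw [sub_self, max_eq_right le_rfl]
    simp only [zero_div, ne_eq, OfNat.ofNat_ne_zero, not_false_eq_true, zero_pow, zero_mul,
      mul_zero]
    rw [hasDerivAt_iff_isLittleO]
    simp only [sub_self, max_eq_right le_rfl, zero_div, ne_eq, OfNat.ofNat_ne_zero,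
      not_false_eq_true, zero_pow, sub_zero, smul_zero]
    have hbig : (fun x' : ℝ => (max (x' - 1 / 10) 0 / (9 / 10)) ^ 4) =O[𝓝 (1 / 10 : ℝ)]
        fun x' => ‖x' - 1 / 10‖ ^ 4 := by
      refine IsBigO.of_bound ((1 / (9 / 10)) ^ 4) (Eventually.of_forall fun x' => ?_)
      have hm : |max (x' - 1 / 10) 0| ≤ |x' - 1 / 10| := by
        rcases le_or_gt (x' - 1 / 10) 0 with h | h
        · rw [max_eq_right h, abs_zero]; exact abs_nonneg _
        · rw [max_eq_left h.le]
      simp only [Real.norm_eq_abs, abs_pow, abs_abs]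
      rw [abs_div, abs_of_pos (by norm_num : (0 : ℝ) < 9 / 10), div_pow]
      calc |max (x' - 1 / 10) 0| ^ 4 / (9 / 10) ^ 4 = (1 / (9 / 10)) ^ 4 * |max (x' - 1 / 10) 0| ^ 4 := by
            ring
        _ ≤ (1 / (9 / 10)) ^ 4 * |x' - 1 / 10| ^ 4 := by gcongr
    exact hbig.trans_isLittleO (isLittleO_pow_sub_sub (1 / 10 : ℝ) (by norm_num))
  · -- right of the corner: a polynomial
    have hev : (fun x : ℝ => (max (x - 1 / 10) 0 / (9 / 10)) ^ 4) =ᶠ[𝓝 x]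
        fun x => ((x - 1 / 10) / (9 / 10)) ^ 4 := by
      filter_upwards [Ioi_mem_nhds hgt] with x' hx'
      rw [max_eq_left (by simp only [mem_Ioi] at hx'; linarith)]
    rw [max_eq_left (by linarith)]
    have h1 : HasDerivAt (fun x : ℝ => (x - 1 / 10) / (9 / 10)) (1 / (9 / 10)) x := by
      have := ((hasDerivAt_id x).sub_const (1 / 10)).div_const (9 / 10)
      simpa using this
    have h4 := h1.pow 4
    simp only [Nat.cast_ofNat, Nat.add_one_sub_one] at h4
    exact h4.congr_of_eventuallyEq hev

/-! ## One-sided tools for the first-exit argument -/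

/-- A function with a strictly negative right derivative at `τ` is strictly below its value at
`τ` immediately after `τ`. [folklore] -/
theorem eventually_lt_of_hasDerivWithinAt_neg {φ : ℝ → ℝ} {φ' τ : ℝ}
    (h : HasDerivWithinAt φ φ' (Ici τ) τ) (hφ' : φ' < 0) : ∀ᶠ t in 𝓝[>] τ, φ t < φ τ := by
  have hslope : Tendsto (slope φ τ) (𝓝[>] τ) (𝓝 φ') := by
    have := (hasDerivWithinAt_iff_tendsto_slope' (s := Ioi τ) (show τ ∉ Ioi τ from
      fun hτ => lt_irrefl τ hτ)).1 h.Ioi_of_Ici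
    exact this
  filter_upwards [hslope.eventually (Iio_mem_nhds hφ'), self_mem_nhdsWithin] with t ht hτt
  have hτt' : 0 < t - τ := sub_pos.2 hτt
  rw [slope_def_field] at ht
  have : φ t - φ τ < 0 := by
    have := mul_neg_of_neg_of_pos ht hτt'
    rwa [div_mul_cancel₀ _ hτt'.ne'] at this
  linarith

/-! ## The invariant region -/

/-- **Barbato–Morandin–Romito 2011, Lemma 2.1 (invariant region), closed form with `ν̄ > 0` and
`ε = 1/100`.** Let `N ∈ ℕ`, `Y : ℕ → ℝ → ℝ` with `Y₀ ≡ 0`, `Y_{N+1} ≡ Y_N`, all modes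
non-negative on `[0, ∞)`, and for `1 ≤ n ≤ N`, `t ≥ 0`,
`Ẏₙ = -dₙYₙ + eₙ(Y_{n-1}² - G YₙY_{n+1})` (one-sided at `0`), where `dₙ > 0`, `d_{n+1} = 4dₙ`,
`eₙ > 0`, `e_{n+1} = Λeₙ`, `3.972 ≤ Λ ≤ 3.9724`, `1 ≤ G ≤ 4`, `G⁻¹ ≤ 0.511` (the rescaled
truncated system (2.2) for `λ = 2`, `β ∈ (2, 5/2]`, `ε = 1/100`: `Λ = λ^{2-ε}`, `G = λ^γ`). If at
`t = 0`: `Yₙ ≤ 1` (`1 ≤ n ≤ N`), `Y_{n+1} ≤ ¾Yₙ + ⅗` and `Y_{n+1} ≥ G⁻¹((Yₙ - 1/10)₊/(9/10))⁴`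
(`1 ≤ n < N`) — every pair `(Yₙ, Y_{n+1})` in the closed region `Ā` — then the same three families
of inequalities hold at every `t ≥ 0`. See the module docstring for the proof and for the
differences from the printed statement. [cite: BarbatoMorandinRomito2011, §2 Lemma 2.1] -/
theorem region_invariant {N : ℕ} {d e : ℕ → ℝ} {Λ G : ℝ} {Y : ℕ → ℝ → ℝ}
    (hΛl : 3972 / 1000 ≤ Λ) (hΛu : Λ ≤ 39724 / 10000) (hG1 : 1 ≤ G) (hG4 : G ≤ 4)
    (hc : 1 / G ≤ 511 / 1000)
    (hd : ∀ n, 1 ≤ n → 0 < d n) (hd4 : ∀ n, 1 ≤ n → d (n + 1) = 4 * d n)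
    (he : ∀ n, 1 ≤ n → 0 < e n) (heΛ : ∀ n, 1 ≤ n → e (n + 1) = Λ * e n)
    (hY0 : ∀ t, Y 0 t = 0) (hYN : ∀ t, Y (N + 1) t = Y N t)
    (hderiv : ∀ n, 1 ≤ n → n ≤ N → ∀ t, 0 ≤ t → HasDerivWithinAt (Y n)
      (-d n * Y n t + e n * (Y (n - 1) t ^ 2 - G * Y n t * Y (n + 1) t)) (Ici 0) t)
    (hpos : ∀ n t, 0 ≤ t → 0 ≤ Y n t)
    (h1 : ∀ n, 1 ≤ n → n ≤ N → Y n 0 ≤ 1)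
    (hup : ∀ n, 1 ≤ n → n + 1 ≤ N → Y (n + 1) 0 ≤ 3 / 4 * Y n 0 + 3 / 5)
    (hlow : ∀ n, 1 ≤ n → n + 1 ≤ N →
      1 / G * (max (Y n 0 - 1 / 10) 0 / (9 / 10)) ^ 4 ≤ Y (n + 1) 0) :
    ∀ t, 0 ≤ t →
      (∀ n, 1 ≤ n → n ≤ N → Y n t ≤ 1) ∧
      (∀ n, 1 ≤ n → n + 1 ≤ N → Y (n + 1) t ≤ 3 / 4 * Y n t + 3 / 5) ∧
      (∀ n, 1 ≤ n → n + 1 ≤ N →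
        1 / G * (max (Y n t - 1 / 10) 0 / (9 / 10)) ^ 4 ≤ Y (n + 1) t) := by
  have hG0 : 0 < G := by linarith
  -- the property and the data
  set P : ℝ → Prop := fun t =>
    (∀ n, 1 ≤ n → n ≤ N → Y n t ≤ 1) ∧
      (∀ n, 1 ≤ n → n + 1 ≤ N → Y (n + 1) t ≤ 3 / 4 * Y n t + 3 / 5) ∧
      (∀ n, 1 ≤ n → n + 1 ≤ N →
        1 / G * (max (Y n t - 1 / 10) 0 / (9 / 10)) ^ 4 ≤ Y (n + 1) t) with hP
  have hP0 : P 0 := ⟨h1, hup, hlow⟩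
  intro T hT
  show P T
  -- continuity of the modes `0, …, N + 1` on `[0, ∞)`
  have hcont : ∀ n, n ≤ N + 1 → ContinuousOn (Y n) (Ici 0) := by
    intro n hn
    rcases Nat.eq_zero_or_pos n with rfl | hn0
    · have : Y 0 = fun _ => 0 := funext hY0
      rw [this]; exact continuousOn_const
    rcases lt_or_eq_of_le hn with hlt | heq
    · exact fun t ht => (hderiv n hn0 (by omega) t ht).continuousWithinAt
    · have : Y n = Y N := by rw [heq]; exact funext hYN
      rw [this]
      rcases Nat.eq_zero_or_pos N with hN0 | hN0
      · have : Y N = fun _ => 0 := by rw [hN0]; exact funext hY0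
        rw [this]; exact continuousOn_const
      · exact fun t ht => (hderiv N hN0 le_rfl t ht).continuousWithinAt
  have hcont_h : ∀ n, n ≤ N + 1 →
      ContinuousOn (fun t => 1 / G * (max (Y n t - 1 / 10) 0 / (9 / 10)) ^ 4) (Ici 0) := by
    intro n hn
    have hc : Continuous fun x : ℝ => 1 / G * (max (x - 1 / 10) 0 / (9 / 10)) ^ 4 :=
      continuous_iff_continuousAt.2 fun x => (hasDerivAt_hlow G x).continuousAt
    exact hc.comp_continuousOn (hcont n hn)
  -- closedness of `P` under limits from the left
  have hclosed : ∀ t ∈ Ioc 0 T, (∀ s ∈ Ico 0 t, P s) → P t := by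
    intro t ht hPs
    have htI : t ∈ Ioc 0 t := ⟨ht.1, le_rfl⟩
    have hle : ∀ {f g : ℝ → ℝ}, ContinuousOn f (Ici 0) → ContinuousOn g (Ici 0) →
        (∀ s ∈ Ico 0 t, f s ≤ g s) → f t ≤ g t := by
      intro f g hf hg hfg
      have h := Literature.Analysis.ODE.le_const_of_forall_Ico (g := fun s => f s - g s) (C := 0)
        ((hf.sub hg).mono Icc_subset_Ici_self) htI fun s hs => sub_nonpos.2 (hfg s hs)
      exact sub_nonpos.1 h
    refine ⟨fun n hn1 hnN => ?_, fun n hn1 hnN => ?_, fun n hn1 hnN => ?_⟩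
    · exact hle (hcont n (by omega)) continuousOn_const fun s hs => (hPs s hs).1 n hn1 hnN
    · exact hle (f := Y (n + 1)) (g := fun s => 3 / 4 * Y n s + 3 / 5) (hcont (n + 1) (by omega))
        ((continuousOn_const.mul (hcont n (by omega))).add continuousOn_const)
        fun s hs => (hPs s hs).2.1 n hn1 hnN
    · exact hle (hcont_h n (by omega)) (hcont (n + 1) (by omega))
        fun s hs => (hPs s hs).2.2 n hn1 hnN
  -- the maximal time
  set τ := Literature.Analysis.ODE.maximalTimeP P 0 T with hτ
  have hτmem : τ ∈ Icc 0 T := Literature.Analysis.ODE.maximalTimeP_mem hT hP0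
  have hspec : ∀ t ∈ Icc 0 τ, P t := fun t ht =>
    Literature.Analysis.ODE.maximalTimeP_spec hT hP0 hclosed ht
  rcases eq_or_lt_of_le hτmem.2 with hτT | hτT
  · exact hspec T ⟨hT, hτT.ge⟩
  exfalso
  refine Literature.Analysis.ODE.not_eventually_of_maximalTimeP_lt hT hP0 hτT ?_
  -- `P` at the maximal time
  have hτ0 : 0 ≤ τ := hτmem.1
  obtain ⟨hPτ1, hPτ2, hPτ3⟩ := hspec τ ⟨hτ0, le_rfl⟩
  -- right-continuity of the players at `τ`
  have hcw : ∀ n, n ≤ N + 1 → ContinuousWithinAt (Y n) (Ioi τ) τ := fun n hn =>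
    ((hcont n hn) τ hτ0).mono fun s hs => hτ0.trans (le_of_lt hs)
  have hcw_h : ∀ n, n ≤ N + 1 → ContinuousWithinAt
      (fun t => 1 / G * (max (Y n t - 1 / 10) 0 / (9 / 10)) ^ 4) (Ioi τ) τ := fun n hn =>
    ((hcont_h n hn) τ hτ0).mono fun s hs => hτ0.trans (le_of_lt hs)
  -- derivatives within `[τ, ∞)` at `τ`
  have hder : ∀ n, 1 ≤ n → n ≤ N → HasDerivWithinAt (Y n)
      (-d n * Y n τ + e n * (Y (n - 1) τ ^ 2 - G * Y n τ * Y (n + 1) τ)) (Ici τ) τ :=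
    fun n hn1 hnN => (hderiv n hn1 hnN τ hτ0).mono (Ici_subset_Ici.2 hτ0)
  -- bounds available at `τ`
  have hYle1 : ∀ n, n ≤ N → Y n τ ≤ 1 := by
    intro n hn
    rcases Nat.eq_zero_or_pos n with rfl | hn0
    · rw [hY0]; exact zero_le_one
    · exact hPτ1 n hn0 hn
  have hY0le : ∀ n, 0 ≤ Y n τ := fun n => hpos n τ hτ0
  -- (1) the top constraints `Yₙ ≤ 1` hold eventually after `τ`
  have evTop : ∀ n ∈ Finset.Icc 1 N, ∀ᶠ t in 𝓝[>] τ, Y n t ≤ 1 := by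
    intro n hn
    rw [Finset.mem_Icc] at hn
    obtain ⟨hn1, hnN⟩ := hn
    rcases lt_or_eq_of_le (hPτ1 n hn1 hnN) with hlt | heq
    · exact (Tendsto.eventually_lt (hcw n (by omega)) continuousWithinAt_const
        hlt).mono fun t ht => ht.le
    · -- active: strictly negative derivative
      have hYnn : 1 / G ≤ Y (n + 1) τ := by
        rcases lt_or_eq_of_le hnN with hlt' | heq'
        · have := hPτ3 n hn1 hlt'
          rwa [heq, hlow_one] at this
        · rw [heq', hYN, ← heq', heq]
          rw [div_le_one hG0]; exact hG1
      have hneg := deriv_top_neg hG0 (hd n hn1) (he n hn1) (Yp := Y (n - 1) τ) heq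
        (hY0le _) (hYle1 (n - 1) (by omega)) hYnn
      exact (eventually_lt_of_hasDerivWithinAt_neg (hder n hn1 hnN) hneg).mono
        fun t ht => by rw [heq] at ht; exact ht.le
  -- (2) the upper constraints `Y_{n+1} ≤ ¾Yₙ + ⅗` hold eventually after `τ`
  have evUp : ∀ n ∈ Finset.Icc 1 (N - 1), ∀ᶠ t in 𝓝[>] τ, Y (n + 1) t ≤ 3 / 4 * Y n t + 3 / 5 := by
    intro n hn
    rw [Finset.mem_Icc] at hn
    obtain ⟨hn1, hnN⟩ := hn
    have hnN' : n + 1 ≤ N := by omega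
    rcases lt_or_eq_of_le (hPτ2 n hn1 hnN') with hlt | heq
    · exact (Tendsto.eventually_lt (f := Y (n + 1)) (g := fun s => 3 / 4 * Y n s + 3 / 5)
        (hcw (n + 1) (by omega)) ((continuousWithinAt_const.mul (hcw n (by omega))).add
          continuousWithinAt_const) hlt).mono fun t ht => ht.le
    · -- active: derivative of `Y_{n+1} - (¾Yₙ + ⅗)` is strictly negative
      have hφ := (hder (n + 1) (by omega) hnN').sub
        (((hder n hn1 (by omega)).const_mul (3 / 4 : ℝ)).add_const (3 / 5 : ℝ))
      have hz : 1 / G * (max (Y (n + 1) τ - 1 / 10) 0 / (9 / 10)) ^ 4 ≤ Y (n + 2) τ := by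
        rcases lt_or_eq_of_le hnN' with hlt' | heq'
        · exact hPτ3 (n + 1) (by omega) hlt'
        · have : Y (n + 2) τ = Y (n + 1) τ := by
            rw [show n + 2 = N + 1 by omega, hYN, ← heq']
          rw [this]
          exact hlow_le_self hG1 (hY0le _) (hYle1 (n + 1) hnN')
      have hneg := deriv_upper_neg hΛl hΛu hG0 hG4 (hd n hn1) (he n hn1) (Yp := Y (n - 1) τ)
        (hY0le n) heq (hYle1 (n + 1) hnN') hz
      have hval : -d (n + 1) * Y (n + 1) τ + e (n + 1) * (Y (n + 1 - 1) τ ^ 2 -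
          G * Y (n + 1) τ * Y (n + 1 + 1) τ) - 3 / 4 * (-d n * Y n τ + e n * (Y (n - 1) τ ^ 2 -
          G * Y n τ * Y (n + 1) τ)) < 0 := by
        rw [hd4 n hn1, heΛ n hn1, Nat.add_sub_cancel, show n + 1 + 1 = n + 2 by ring]
        linarith [hneg]
      have hev := eventually_lt_of_hasDerivWithinAt_neg hφ hval
      refine hev.mono fun t ht => ?_
      have h0 : Y (n + 1) τ - (3 / 4 * Y n τ + 3 / 5) = 0 := by rw [heq]; ring
      simp only [Pi.sub_apply] at ht
      linarith
  -- (3) the lower constraints `h(Yₙ) ≤ Y_{n+1}` hold eventually after `τ`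
  have evLow : ∀ n ∈ Finset.Icc 1 (N - 1), ∀ᶠ t in 𝓝[>] τ,
      1 / G * (max (Y n t - 1 / 10) 0 / (9 / 10)) ^ 4 ≤ Y (n + 1) t := by
    intro n hn
    rw [Finset.mem_Icc] at hn
    obtain ⟨hn1, hnN⟩ := hn
    have hnN' : n + 1 ≤ N := by omega
    rcases lt_or_ge (Y n τ) (1 / 10) with hsmall | hbig
    · -- `Yₙ < δ` persists for a while, and there `h(Yₙ) = 0 ≤ Y_{n+1}`
      have hev := Tendsto.eventually_lt (hcw n (by omega)) continuousWithinAt_const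
        hsmall
      filter_upwards [hev, self_mem_nhdsWithin] with t ht hτt
      rw [hlow_eq_zero_of_le G ht.le]
      exact hpos (n + 1) t (hτ0.trans (le_of_lt hτt))
    rcases lt_or_eq_of_le (hPτ3 n hn1 hnN') with hlt | heq
    · exact (Tendsto.eventually_lt (hcw_h n (by omega)) (hcw (n + 1) (by omega))
        hlt).mono fun t ht => ht.le
    · -- active with `Yₙ ≥ δ`: derivative of `h(Yₙ) - Y_{n+1}` is strictly negative
      have hmax : max (Y n τ - 1 / 10) 0 = Y n τ - 1 / 10 := max_eq_left (by linarith)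
      have hcomp := (hasDerivAt_hlow G (Y n τ)).comp_hasDerivWithinAt τ (hder n hn1 (by omega))
      have hφ := hcomp.sub (hder (n + 1) (by omega) hnN')
      have hz : Y (n + 2) τ ≤ 3 / 4 * Y (n + 1) τ + 3 / 5 := by
        rcases lt_or_eq_of_le hnN' with hlt' | heq'
        · exact hPτ2 (n + 1) (by omega) hlt'
        · have : Y (n + 2) τ = Y (n + 1) τ := by
            rw [show n + 2 = N + 1 by omega, hYN, ← heq']
          rw [this]
          linarith [hYle1 (n + 1) hnN', hY0le (n + 1)]
      have hy : Y (n + 1) τ = 1 / G * ((Y n τ - 1 / 10) / (9 / 10)) ^ 4 := by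
        rw [← heq, hmax]
      have hneg := deriv_lower_neg hΛl hΛu hG0 hc (hd n hn1) (he n hn1) (Yp := Y (n - 1) τ)
        hbig (hYle1 n (by omega)) hy hz (hY0le _) (hYle1 (n - 1) (by omega))
      have hval : 1 / G * (4 * (max (Y n τ - 1 / 10) 0 / (9 / 10)) ^ 3 * (1 / (9 / 10))) *
          (-d n * Y n τ + e n * (Y (n - 1) τ ^ 2 - G * Y n τ * Y (n + 1) τ)) -
          (-d (n + 1) * Y (n + 1) τ + e (n + 1) * (Y (n + 1 - 1) τ ^ 2 -
            G * Y (n + 1) τ * Y (n + 1 + 1) τ)) < 0 := by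
        rw [hmax, hd4 n hn1, heΛ n hn1, Nat.add_sub_cancel, show n + 1 + 1 = n + 2 by ring]
        have hre : 1 / G * (4 * ((Y n τ - 1 / 10) / (9 / 10)) ^ 3 * (1 / (9 / 10))) =
            4 / G * ((Y n τ - 1 / 10) / (9 / 10)) ^ 3 / (9 / 10) := by ring
        rw [hre]
        linarith [hneg]
      have hev := eventually_lt_of_hasDerivWithinAt_neg hφ hval
      refine hev.mono fun t ht => ?_
      simp only [Pi.sub_apply, Function.comp_apply] at ht
      rw [heq, sub_self] at ht
      linarith
  -- assemble: `P` eventually after `τ`, hence eventually at `τ` within `[0, T]`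
  have evP : ∀ᶠ t in 𝓝[>] τ, P t := by
    have e1 := (Finset.eventually_all (Finset.Icc 1 N)).2 evTop
    have e2 := (Finset.eventually_all (Finset.Icc 1 (N - 1))).2 evUp
    have e3 := (Finset.eventually_all (Finset.Icc 1 (N - 1))).2 evLow
    filter_upwards [e1, e2, e3] with t ht1 ht2 ht3
    refine ⟨fun n hn1 hnN => ht1 n (Finset.mem_Icc.2 ⟨hn1, hnN⟩),
      fun n hn1 hnN => ht2 n (Finset.mem_Icc.2 ⟨hn1, by omega⟩),
      fun n hn1 hnN => ht3 n (Finset.mem_Icc.2 ⟨hn1, by omega⟩)⟩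
  rw [eventually_nhdsWithin_iff] at evP ⊢
  filter_upwards [evP] with t ht htI
  rcases le_or_gt t τ with hle | hgt
  · exact hspec t ⟨htI.1, hle⟩
  · exact ht hgt

end Literature.Barriers.NavierStokesRegularity.Dyadic
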